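import Summits.AtomisticToContinuum.Crystallization.Theses.GrandCanonicalSelection

/-!
# `GrandCanonicalSelection.SelectedGrandStability` (stmt-AtomisticToContinuum-13684) — proof

STAIRCASE SELECTION (finite argmin, no iteration). For any real sequence `E : ℕ → ℝ` with
`E N / N → e` and `e ≤ E N / N` for `N ≥ 1`, put `a N := E N − e N ≥ 0`, so `a N / N → 0`.
Fix `j` and a threshold `N₀`. With `T := (j+1)²`, eventually `a N · 4T ≤ N`; choose
`K ≥ max N₀ N₁ (2j+1)` and minimise `g M := a M + |M − 2K| / T` over the window `M ∈ [K, 3K]`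
(`Finset.exists_min_image`). Comparing the minimiser `N` with the centre `2K` gives
`|N − 2K| ≤ T · a(2K) ≤ K/2`, so every `M` with `|M − N| ≤ j` lies in `[K, 3K]`, and then
`g N ≤ g M` gives `a N ≤ a M + |M − N| / T ≤ a M + j/(j+1)² ≤ a M + 1/(j+1)`. Hence the window
property holds frequently in `N` for every `j`, and `Filter.extraction_forall_of_frequently`
extracts a strictly increasing `φ`.

This is the DOOR item of route-AtomisticToContinuum-KosselSieveDial (decomp-a2c lens 5, generation 9)
and its BC5 rung; a prover lands it with `--workitem stmt-AtomisticToContinuum-13684`.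
-/

namespace Summit.AtomisticToContinuum.Crystallization.Theorems.GrandCanonicalSelectionSelectedGrandStability

open Filter Topology

/-- Abstract staircase selection: for a real sequence with `E N / N → e` from above, there is a strictly
increasing `φ` such that `E (φ j) − e φ j ≤ E M − e M + 1/(j+1)` whenever `|M − φ j| ≤ j`. -/
theorem staircase_selection (E : ℕ → ℝ) (e : ℝ)
    (h1 : Tendsto (fun N : ℕ => E N / N) atTop (𝓝 e))
    (h2 : ∀ N : ℕ, 0 < N → e ≤ E N / N) :
    ∃ φ : ℕ → ℕ, StrictMono φ ∧ ∀ j M : ℕ, φ j ≤ M + j → M ≤ φ j + j →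
      E (φ j) - e * (φ j) ≤ E M - e * M + 1 / ((j : ℝ) + 1) := by
  -- the excess `a N := E N - e N` is nonnegative for `N ≥ 1` and sublinear
  have ha0 : ∀ N : ℕ, 0 < N → 0 ≤ E N - e * N := by
    intro N hN
    have hNpos : (0 : ℝ) < N := by exact_mod_cast hN
    have := h2 N hN
    rw [le_div_iff₀ hNpos] at this
    linarith
  have key : ∀ j : ℕ, ∃ᶠ N in atTop, ∀ M : ℕ, N ≤ M + j → M ≤ N + j →
      E N - e * N ≤ E M - e * M + 1 / ((j : ℝ) + 1) := by
    intro j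
    set T : ℝ := ((j : ℝ) + 1) ^ 2 with hT
    have hTpos : 0 < T := by positivity
    -- eventual sublinear bound `a N · 4T ≤ N`
    have hev : ∀ᶠ N : ℕ in atTop, (E N - e * N) * (4 * T) ≤ N := by
      have h1' := (Metric.tendsto_nhds.1 h1) (1 / (4 * T)) (by positivity)
      filter_upwards [h1', eventually_ge_atTop 1] with N hN hN1
      have hNpos : (0 : ℝ) < N := by exact_mod_cast hN1
      rw [Real.dist_eq] at hN
      have h3 : E N / N - e ≤ 1 / (4 * T) := (abs_lt.1 hN).2.le
      have h4 : E N - e * N = (E N / N - e) * N := by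
        field_simp
      rw [h4]
      calc (E N / N - e) * N * (4 * T) ≤ 1 / (4 * T) * N * (4 * T) := by gcongr
        _ = N := by field_simp
    rw [frequently_atTop]
    intro N₀
    obtain ⟨N₁, hN₁⟩ := eventually_atTop.1 hev
    set K : ℕ := max (max N₀ N₁) (2 * j + 1) with hK
    have hK0 : N₀ ≤ K := le_trans (le_max_left _ _) (le_max_left _ _)
    have hK1 : N₁ ≤ K := le_trans (le_max_right _ _) (le_max_left _ _)
    have hKj : 2 * j + 1 ≤ K := le_max_right _ _
    have hKjR : (2 * j + 1 : ℝ) ≤ K := by exact_mod_cast hKj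
    -- the penalised functional on the window [K, 3K] with centre c = 2K
    set c : ℝ := 2 * (K : ℝ) with hc
    obtain ⟨N, hNS, hmin⟩ := (Finset.Icc K (3 * K)).exists_min_image
      (fun M : ℕ => (E M - e * M) + (1 / T) * |(M : ℝ) - c|)
      ⟨K, by simp only [Finset.mem_Icc]; omega⟩
    have hNK := Finset.mem_Icc.1 hNS
    refine ⟨N, le_trans hK0 hNK.1, ?_⟩
    intro M hM1 hM2
    have hNKR : (K : ℝ) ≤ N := by exact_mod_cast hNK.1
    have hM1R : (N : ℝ) ≤ M + j := by exact_mod_cast hM1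
    have hM2R : (M : ℝ) ≤ N + j := by exact_mod_cast hM2
    -- compare the minimiser with the centre 2K
    have h2K : 2 * K ∈ Finset.Icc K (3 * K) := by simp only [Finset.mem_Icc]; omega
    have hgc := hmin (2 * K) h2K
    have hcast : ((2 * K : ℕ) : ℝ) = c := by rw [hc]; push_cast; ring
    rw [hcast, sub_self, abs_zero, mul_zero, add_zero] at hgc
    have haN : 0 ≤ E N - e * N := ha0 N (by omega)
    have hc4 := hN₁ (2 * K) (by omega)
    rw [hcast] at hc4
    -- |N - c| ≤ T · a(2K) ≤ K / 2
    have hNc : |(N : ℝ) - c| ≤ (K : ℝ) / 2 := by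
      have h5 : (1 / T) * |(N : ℝ) - c| ≤ E (2 * K) - e * c := by linarith
      have h6 : |(N : ℝ) - c| ≤ T * (E (2 * K) - e * c) := by
        have := mul_le_mul_of_nonneg_left h5 hTpos.le
        rwa [← mul_assoc, mul_one_div_cancel hTpos.ne', one_mul] at this
      have h7 : T * (E (2 * K) - e * c) ≤ (K : ℝ) / 2 := by
        rw [hc] at hc4 ⊢
        nlinarith
      linarith
    -- every M with |M - N| ≤ j lies in the window
    have hMS : M ∈ Finset.Icc K (3 * K) := by
      rw [Finset.mem_Icc]
      rw [abs_le] at hNc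
      constructor
      · by_contra h
        push Not at h
        have : (M : ℝ) + 1 ≤ K := by exact_mod_cast h
        rw [hc] at hNc
        linarith [hNc.1]
      · by_contra h
        push Not at h
        have : (3 * K : ℝ) + 1 ≤ M := by exact_mod_cast h
        rw [hc] at hNc
        linarith [hNc.2]
    have hgM := hmin M hMS
    have htri : |(M : ℝ) - c| - |(N : ℝ) - c| ≤ |(M : ℝ) - N| := by
      have := abs_sub_abs_le_abs_sub ((M : ℝ) - c) ((N : ℝ) - c)
      have h8 : (M : ℝ) - c - ((N : ℝ) - c) = (M : ℝ) - N := by ring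
      rwa [h8] at this
    have hMN : |(M : ℝ) - N| ≤ j := by
      rw [abs_le]; constructor <;> linarith
    have hjT : (j : ℝ) / T ≤ 1 / ((j : ℝ) + 1) := by
      rw [hT, div_le_div_iff₀ hTpos (by positivity)]
      nlinarith
    have hT1 : 0 ≤ 1 / T := by positivity
    calc E N - e * N ≤ (E M - e * M) + (1 / T) * (|(M : ℝ) - c| - |(N : ℝ) - c|) := by linarith
      _ ≤ (E M - e * M) + (1 / T) * |(M : ℝ) - N| := by gcongr
      _ ≤ (E M - e * M) + (1 / T) * j := by gcongr
      _ = (E M - e * M) + j / T := by ring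
      _ ≤ E M - e * M + 1 / ((j : ℝ) + 1) := by linarith
  obtain ⟨φ, hφ, hφP⟩ := Filter.extraction_forall_of_frequently key
  exact ⟨φ, hφ, fun j M hM1 hM2 => hφP j M hM1 hM2⟩

/-- PROOF OF THE ITEM `GrandCanonicalSelection.SelectedGrandStability` (stmt-AtomisticToContinuum-13684):
staircase selection applied to `E(N) = groundStateEnergy lennardJones 3 N`. -/
theorem selectedGrandStability :
    Summit.AtomisticToContinuum.Crystallization.Theses.GrandCanonicalSelection.SelectedGrandStability := by
  intro e h1 h2
  exact staircase_selection _ e h1 h2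

end Summit.AtomisticToContinuum.Crystallization.Theorems.GrandCanonicalSelectionSelectedGrandStability
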